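import Summits.HodgeConjecture.HodgeConjecture.Theorems.F0P2oYCoinvariantsChart             -- (E1-gen): the chart export of the abstract assembler
import Summits.HodgeConjecture.HodgeConjecture.Theorems.F0P2oYCoinvariantsCM                -- ★ p832817: the CM closer (its two scalar lemmas)
import Summits.HodgeConjecture.HodgeConjecture.Theorems.F0P2oPairFrameOfFormCongruence     -- ★ p832092: the pair frame package
import Summits.HodgeConjecture.HodgeConjecture.Theorems.F0P2oCmLineDockingMatrix           -- ★ p832169 (F0P3a-p03 (g8)): the two docking identities
import Literature.NumberTheory.GelbartRogawski1991.FiniteAdelicSplittingAssembly          -- ★ `FinLocalSplittings`, `iota`, `localSchrodinger`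
import Literature.NumberTheory.GelbartRogawski1991.UnitaryDualPairThetaKernelCM          -- ★ `imagUnit`, `realDiagonal`
import Literature.NumberTheory.GelbartRogawski1991.UnitaryDualPairSplittingDatum         -- ★ `gram`, `isUnit_det_gram`
import Literature.NumberTheory.Automorphic.Liu2021.Def411WeilCarriers                    -- ★ `TW`, `JW`
import Literature.NumberTheory.Automorphic.UnitaryGroupDualPairLocalLine                 -- ★ `localLineInl`
import Literature.NumberTheory.Automorphic.LocalUnitaryGroupCongr                        -- ★ `cmDatumLocalCongr`
import Literature.NumberTheory.Automorphic.UnitaryGroupBorelInduction                     -- ★ `cmBorelTriple`, `cmLocalForm_eq_over`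
import Literature.NumberTheory.Automorphic.UnitaryGroupRankOneBigCell                     -- ★ p831034: `U(σ, Φ₃)(K)` by entries
import Literature.NumberTheory.Automorphic.UnitaryGroupNonsplitPlace                      -- ★ `LocalRing.isField_of_smul_eq`
import HarnessLib

/-!
# Crux `H413`, programme P2, N3 road (a)-block (E1-CM) — THE CHART OF THE CM CLOSER: `r_N(ω_v)` at a non-split place WITH its frame chart, intertwiner,
# transported splitting and fibre map (★ p832817 re-run with nothing dropped)

Cell hodgecm-mathlib (D-0151), FLOOR 0, crux item H413 = stmt-HodgeConjecture-24833, programme P2; N3 road (`F0/P2/B-p18/g28/N3-ROAD.v2.B-p18g28.md`),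
(a)-block, row (S5) «THE DICTIONARY» (lead B-p18 (g28) 20:49:54Z, desk F0P2-plan (g8) 20:50:18Z), seat F0P2-p01 (g8), brick (E1-CM) over (E1-gen)
`F0P2oYCoinvariantsChart.exists_chart_of_frame`.  THEOREMS ONLY (no `def`, no instance, no notation, no named fact, no `sorry`); never imports a
`Cruxes/…/Lines` module; kernel lane `--supports stmt-HodgeConjecture-24833 --as helper`.  HC_CM is proved only modulo the printed citations until rung 0
closes; nothing printed is asserted here.

WHY.  ★ p832817 `exists_coinvariants_equiv_schwartz_of_nonsplit` exports `Nonempty (r_N(ω_v ∘ ch) ≃ₗ[ℂ] 𝒮(L⁺_v))` ONLY: no action of the Levi `M = E_w^× × E¹_v`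
nor of the centre `U(W) = E¹_v` can be read on `𝒮(L⁺_v)` through it.  The N3 letter's clause (a) (★ `GelbartRogawski1991.thetaType_nonsplit_jacquetModule`) asks
for the `χ_{f,v}`-part of `r_N(ω_v)` under the centre to be the `ψθ`-weight space of ★ `lineWeilCM` — which needs those actions; so does the (D3d) Schur step
«`m(α)` acts on `𝒮 ⧸ K` by a scalar».  `exists_chart_of_nonsplit` below is ★ p832817 with the chart `Γ`, the intertwiner `Ψ`, the transported splitting `s′`
and the fibre map `φ₀` KEPT, plus the frame data (`u = a·ε = φ(a₀)`, the pair form `reindex e₁ (diag dV ⊗ (ε))`, the matrix `reindex e₁ (T g T⁻¹ ⊗ 1)` of `ch g`).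
Downstream every action is computed in the dot model: `Ψ ω_v(ch g) Ψ⁻¹ = ω_{s′}(g)`, `(s′ g)` acts through `Γ` by `T g T⁻¹`, `K = Ψ⁻¹(ker φ₀)`, and ★ p830834 §3 ∕ ★ p831043
§1 descend `Y`-stable elements to `S_Y = 𝒮(L⁺_v)`.
[Kudla1986, Thm. 2.8; MoeglinVignerasWaldspurger1987, Chap. 3 §IV.2, §IV.5; GelbartRogawski1991, §3.2 (3.2.3) p. 457; Rogawski1990, §1.10 p. 9.]

## References
* [Kudla1986] S. Kudla, *On the local theta-correspondence*, Invent. Math. 83 (1986): Thm. 2.8.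
* [MoeglinVignerasWaldspurger1987] C. Mœglin, M.-F. Vignéras, J.-L. Waldspurger, LNM 1291 (1987): Chap. 3 §IV.2, §IV.5.
* [GelbartRogawski1991] S. Gelbart, J. Rogawski, Invent. Math. 105 (1991): §3.2 (3.2.1)–(3.2.3) p. 457.
* [Rogawski1990] J. D. Rogawski, Ann. of Math. Stud. 123 (1990): §1.9 p. 8, §1.10 p. 9.
-/

set_option autoImplicit false
set_option linter.dupNamespace false -- the mandated namespace repeats the single-problem summit's segment

noncomputable section

open scoped MatrixGroups Kronecker
open _root_.Matrix NumberField IsDedekindDomain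
open Literature.NumberTheory.Automorphic Literature.NumberTheory.Automorphic.UnitaryGroup
open Literature.NumberTheory.Automorphic.UnitaryGroup.QuadraticCoordinates Literature.NumberTheory.Automorphic.UnitaryGroup.IsQuadraticCoordinates
open Literature.NumberTheory.Automorphic.Liu2021 Literature.NumberTheory.Automorphic.Liu2021.Def411WeilCarriers
open Literature.NumberTheory.GelbartRogawski1991 Literature.NumberTheory.GelbartRogawski1991.UnitaryDualPair
open Literature.NumberTheory.GelbartRogawski1991.UnitaryDualPair.LocalSplitting
open Literature.RepresentationTheory Literature.RepresentationTheory.HeisenbergGroup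
open Summit.HodgeConjecture.HodgeConjecture.Cruxes.H413.F0P2oYCoinvariantsOfFrameAssembly
open Summit.HodgeConjecture.HodgeConjecture.Cruxes.H413.F0P2oYCoinvariantsChart
open Summit.HodgeConjecture.HodgeConjecture.Cruxes.H413.F0P2oYCoinvariantsCM
open Summit.HodgeConjecture.HodgeConjecture.Cruxes.H413.F0P2oPairFrameOfFormCongruence
open Summit.HodgeConjecture.HodgeConjecture.Cruxes.H413.F0P2oFrameOfFormCongruence
open Summit.HodgeConjecture.HodgeConjecture.Cruxes.H413.F0P2oParabolicLineChartDocking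
open Summit.HodgeConjecture.HodgeConjecture.Cruxes.H413.F0P2oCmLineDockingMatrix

namespace Summit.HodgeConjecture.HodgeConjecture.Cruxes.H413.F0P2oYCoinvariantsChartCM

section Chart

variable (L : Type) [Field L] [NumberField L] [IsCMField L]

set_option synthInstance.maxHeartbeats 400000 in
set_option maxHeartbeats 16000000 in
/-- **THE CHART OF THE CM CLOSER** — at a place `v ∤ ∞` of `L⁺` NOT split in `L`, for ANY local splitting package `𝓢` of the pair `U(diag dV ⊗ (ε))`
read on `U(Φ₃)(L⁺_v)` along a form congruence `(T, a, h)` (binders = ★ p832817 `exists_coinvariants_equiv_schwartz_of_nonsplit` VERBATIM): there are the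
frame unit `u = a·ε` (real: `u = φ(a₀)`), the frame chart `Γ` of `𝕎_v = F_v^{n′} × F_v^{n′}` onto the dot model `F_v^{Fin 2 ⊔ Fin 1} × F_v^{Fin 2 ⊔ Fin 1}` adapted to the
hyperbolic frame `x₀ = T.col 0` (the isotropic line `Y`), `y₀ = u⁻¹·T.col 2`, `b = T.col 1` (lifted along `e₁`), an intertwiner `Ψ` of Schrödinger models, the transported
splitting `s′` and the fibre map `φ₀`, with: (0) the pair form is `reindex e₁ (diag dV ⊗ (ε))`; (i) the chart formula `Γ (reIm x) = ((re⟨x₀,x⟩, im⟨x₀,x⟩ ‖ a₀⁻¹ re⟨b,x⟩),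
(im⟨y₀,x⟩, −re⟨y₀,x⟩ ‖ im⟨b,x⟩))` and `Γ` symplectic; (ii) `Ψ (ρ_v(w,t) f) = ρ_dot(Γ w, t + ½(β_dot(Γw,Γw) − β_v(w,w))) (Ψ f)`; (iii) `Ψ (ω_v(ch g) f) = ω_{s′}(g) (Ψ f)`,
`ch = localLineInl ∘ localPiEquiv⁻¹ ∘ cmDatumLocalCongr T` (kept as a composite `MonoidHom`; `MonoidHom.comp_apply` is `rfl`); (iv) `(s′ g)·Γ(reIm x) = Γ(reIm (reindex e₁ (T g T⁻¹ ⊗ 1) · x))`; (v) `(φ₀ f)(u₀) = f(0 ‖ u₀)`;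
(vi) `Coinvariants.ker ((ω_v ∘ ch)|_N) = Ψ⁻¹(ker φ₀)` (`N` = the unipotent radical of ★ `cmBorelTriple L 3 v`).  This is ★ p832817 with its chart KEPT (proof = that proof,
ending in `exists_chart_of_frame`); every group action on `r_N(ω_v)` is read through (iii)(iv)(vi) in the dot model (★ p830834 ∕ p831043 ∕ p831322).
[cite: Kudla1986, Thm. 2.8] [cite: MoeglinVignerasWaldspurger1987, Chap. 3 §IV.2, §IV.5] [cite: GelbartRogawski1991, §3.2 (3.2.3) p. 457] [cite: Rogawski1990, §1.10 p. 9] -/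
theorem exists_chart_of_nonsplit {n' : ℕ} (e₁ : Fin 3 × Fin 1 ≃ Fin n') (dV : Fin 3 → L)
    (hdV : ∀ i, IsCMField.complexConj L (dV i) = dV i) (hdV0 : ∀ i, dV i ≠ 0) (ε : (↥(maximalRealSubfield L))ˣ)
    (v : HeightOneSpectrum (𝓞 ↥(maximalRealSubfield L))) (hv : ∀ w : PlacesOver L v, IsCMField.complexConj L • w.1 = w.1)
    (𝓢 : FinLocalSplittings (↥(maximalRealSubfield L)) L (IsCMField.complexConj L) n' (complexConj_imagUnit L) (imagUnit_ne_zero L)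
      (imagUnit_mul_self L) (gram (↥(maximalRealSubfield L)) e₁ (realDiagonal L dV hdV) (TW (↥(maximalRealSubfield L)) ε))
      (isSymm_gram (↥(maximalRealSubfield L)) e₁ (realDiagonal_isSymm L dV hdV) (isSymm_TW (↥(maximalRealSubfield L)) ε))
      (J := Matrix.reindex e₁ e₁ (Matrix.diagonal dV ⊗ₖ JW (↥(maximalRealSubfield L)) L ε))
      (reindex_kronecker_eq_gram_map (↥(maximalRealSubfield L)) L e₁ (realDiagonal_map L dV hdV).symm (JW_eq (↥(maximalRealSubfield L)) L ε)))
    (T : GL (Fin 3) (UnitaryGroup.LocalRing L v)) {a : UnitaryGroup.LocalRing L v} (ha : IsUnit a)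
    (h : formCongr (conjLocal L (IsCMField.complexConj L) v) T ((Matrix.diagonal dV).map (algebraMap L (UnitaryGroup.LocalRing L v))) =
      a • (Matrix.of fun i j : Fin 3 => if i.val + j.val + 1 = 3 then (1 : L) else 0).map (algebraMap L (UnitaryGroup.LocalRing L v))) :
    ∃ (u : (UnitaryGroup.LocalRing L v)ˣ) (a₀ : (v.adicCompletion ↥(maximalRealSubfield L)))
      (Γ : ((Fin n' → (v.adicCompletion ↥(maximalRealSubfield L))) × (Fin n' → (v.adicCompletion ↥(maximalRealSubfield L)))) ≃ₗ[(v.adicCompletion ↥(maximalRealSubfield L))] (((Fin 2 ⊕ Fin 1) → (v.adicCompletion ↥(maximalRealSubfield L))) × ((Fin 2 ⊕ Fin 1) → (v.adicCompletion ↥(maximalRealSubfield L)))))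
      (Ψ : SchwartzBruhat (Fin n' → (v.adicCompletion ↥(maximalRealSubfield L))) ≃ₗ[ℂ] SchwartzBruhat ((Fin 2 ⊕ Fin 1) → (v.adicCompletion ↥(maximalRealSubfield L))))
      (s' : (cmDatum L 3 (Matrix.of fun i j : Fin 3 => if i.val + j.val + 1 = 3 then (1 : L) else 0)).Local v →* MpPsi (schrodingerSB (dotProductBilin (v.adicCompletion ↥(maximalRealSubfield L)) (v.adicCompletion ↥(maximalRealSubfield L)) (m := Fin 2 ⊕ Fin 1)) (adeleAddCharAt (↥(maximalRealSubfield L)) v) (isLocallyConstant_of_isContinuousNontrivial (isContinuousNontrivial_adeleAddCharAt (↥(maximalRealSubfield L)) v)) (fun y => continuous_dotProductBilin_left y)))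
      (φ₀ : SchwartzBruhat ((Fin 2 ⊕ Fin 1) → (v.adicCompletion ↥(maximalRealSubfield L))) →ₗ[ℂ] SchwartzBruhat (Fin 1 → (v.adicCompletion ↥(maximalRealSubfield L)))),
      -- the frame unit `u = a · ε`, real: `u = φ(a₀)`
      ((u : UnitaryGroup.LocalRing L v) = a * algebraMap L (UnitaryGroup.LocalRing L v) (algebraMap (↥(maximalRealSubfield L)) L (ε : ↥(maximalRealSubfield L))) ∧
        (u : UnitaryGroup.LocalRing L v) = toLocalRing L v a₀) ∧
      -- (0) the pair form on `S^{n′}`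
      ((localGram (↥(maximalRealSubfield L)) n' (gram (↥(maximalRealSubfield L)) e₁ (realDiagonal L dV hdV) (TW (↥(maximalRealSubfield L)) ε)) v).map (toLocalRing L v)) = Matrix.reindex e₁ e₁ (((Matrix.diagonal dV).map (algebraMap L (UnitaryGroup.LocalRing L v))) ⊗ₖ
        ((JW (↥(maximalRealSubfield L)) L ε).map (algebraMap L (UnitaryGroup.LocalRing L v)))) ∧
      -- (i) the chart: forward formula, symplectic
      (∀ x : Fin n' → UnitaryGroup.LocalRing L v, Γ (reIm (quadraticLocalEquiv L v (IsCMField.complexConj L) (complexConj_imagUnit L) (imagUnit_ne_zero L)).toLinearEquiv.toAddEquiv (Fin n') x) =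
        (Sum.elim ![re (quadraticLocalEquiv L v (IsCMField.complexConj L) (complexConj_imagUnit L) (imagUnit_ne_zero L)).toLinearEquiv.toAddEquiv (hermForm (conjLocal L (IsCMField.complexConj L) v) ((localGram (↥(maximalRealSubfield L)) n' (gram (↥(maximalRealSubfield L)) e₁ (realDiagonal L dV hdV) (TW (↥(maximalRealSubfield L)) ε)) v).map (toLocalRing L v)) (fun k => (T : Matrix (Fin 3) (Fin 3) (UnitaryGroup.LocalRing L v)) (e₁.symm k).1 0) x), im (quadraticLocalEquiv L v (IsCMField.complexConj L) (complexConj_imagUnit L) (imagUnit_ne_zero L)).toLinearEquiv.toAddEquiv (hermForm (conjLocal L (IsCMField.complexConj L) v) ((localGram (↥(maximalRealSubfield L)) n' (gram (↥(maximalRealSubfield L)) e₁ (realDiagonal L dV hdV) (TW (↥(maximalRealSubfield L)) ε)) v).map (toLocalRing L v)) (fun k => (T : Matrix (Fin 3) (Fin 3) (UnitaryGroup.LocalRing L v)) (e₁.symm k).1 0) x)]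
            (fun _ => a₀⁻¹ * re (quadraticLocalEquiv L v (IsCMField.complexConj L) (complexConj_imagUnit L) (imagUnit_ne_zero L)).toLinearEquiv.toAddEquiv (hermForm (conjLocal L (IsCMField.complexConj L) v) ((localGram (↥(maximalRealSubfield L)) n' (gram (↥(maximalRealSubfield L)) e₁ (realDiagonal L dV hdV) (TW (↥(maximalRealSubfield L)) ε)) v).map (toLocalRing L v)) (fun k => (T : Matrix (Fin 3) (Fin 3) (UnitaryGroup.LocalRing L v)) (e₁.symm k).1 1) x)),
          Sum.elim ![im (quadraticLocalEquiv L v (IsCMField.complexConj L) (complexConj_imagUnit L) (imagUnit_ne_zero L)).toLinearEquiv.toAddEquiv (hermForm (conjLocal L (IsCMField.complexConj L) v) ((localGram (↥(maximalRealSubfield L)) n' (gram (↥(maximalRealSubfield L)) e₁ (realDiagonal L dV hdV) (TW (↥(maximalRealSubfield L)) ε)) v).map (toLocalRing L v)) (fun k => ((u⁻¹ : (UnitaryGroup.LocalRing L v)ˣ) : UnitaryGroup.LocalRing L v) * (T : Matrix (Fin 3) (Fin 3) (UnitaryGroup.LocalRing L v)) (e₁.symm k).1 2) x), -re (quadraticLocalEquiv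 L v (IsCMField.complexConj L) (complexConj_imagUnit L) (imagUnit_ne_zero L)).toLinearEquiv.toAddEquiv (hermForm (conjLocal L (IsCMField.complexConj L) v) ((localGram (↥(maximalRealSubfield L)) n' (gram (↥(maximalRealSubfield L)) e₁ (realDiagonal L dV hdV) (TW (↥(maximalRealSubfield L)) ε)) v).map (toLocalRing L v)) (fun k => ((u⁻¹ : (UnitaryGroup.LocalRing L v)ˣ) : UnitaryGroup.LocalRing L v) * (T : Matrix (Fin 3) (Fin 3) (UnitaryGroup.LocalRing L v)) (e₁.symm k).1 2) x)]
            (fun _ => im (quadraticLocalEquiv L v (IsCMField.complexConj L) (complexConj_imagUnit L) (imagUnit_ne_zero L)).toLinearEquiv.toAddEquiv (hermForm (conjLocal L (IsCMField.complexConj L) v) ((localGram (↥(maximalRealSubfield L)) n' (gram (↥(maximalRealSubfield L)) e₁ (realDiagonal L dV hdV) (TW (↥(maximalRealSubfield L)) ε)) v).map (toLocalRing L v)) (fun k => (T : Matrix (Fin 3) (Fin 3) (UnitaryGroup.LocalRing L v)) (e₁.symm k).1 1) x)))) ∧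
      (∀ w w' : (Fin n' → (v.adicCompletion ↥(maximalRealSubfield L))) × (Fin n' → (v.adicCompletion ↥(maximalRealSubfield L))), alt (polar (dotProductBilin (v.adicCompletion ↥(maximalRealSubfield L)) (v.adicCompletion ↥(maximalRealSubfield L)) (m := Fin 2 ⊕ Fin 1))) (Γ w) (Γ w') = alt (polar (localPairing (↥(maximalRealSubfield L)) n' (gram (↥(maximalRealSubfield L)) e₁ (realDiagonal L dV hdV) (TW (↥(maximalRealSubfield L)) ε)) v)) w w') ∧
      -- (ii) `Ψ` intertwines the Heisenberg models along the Heisenberg isomorphism over `Γ`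
      (∀ (w : (Fin n' → (v.adicCompletion ↥(maximalRealSubfield L))) × (Fin n' → (v.adicCompletion ↥(maximalRealSubfield L)))) (t : (v.adicCompletion ↥(maximalRealSubfield L))) (f : SchwartzBruhat (Fin n' → (v.adicCompletion ↥(maximalRealSubfield L)))),
        Ψ ((localSchrodinger (↥(maximalRealSubfield L)) n' (gram (↥(maximalRealSubfield L)) e₁ (realDiagonal L dV hdV) (TW (↥(maximalRealSubfield L)) ε)) v) ⟨w, t⟩ f) = (schrodingerSB (dotProductBilin (v.adicCompletion ↥(maximalRealSubfield L)) (v.adicCompletion ↥(maximalRealSubfield L)) (m := Fin 2 ⊕ Fin 1)) (adeleAddCharAt (↥(maximalRealSubfield L)) v) (isLocallyConstant_of_isContinuousNontrivial (isContinuousNontrivial_adeleAddCharAt (↥(maximalRealSubfield L)) v)) (fun y => continuous_dotProductBilin_left y)) ⟨Γ w, t + ⅟(2 : (v.adicCompletion ↥(maximalRealSubfield L))) * ((polar (dotProductBilin (v.adicCompletion ↥(maximalRealSubfield L)) (v.adicCompletion ↥(maximalRealSubfield L)) (m := Fin 2 ⊕ Fin 1))) (Γ w) (Γ w) - (polar (localPairing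 (↥(maximalRealSubfield L)) n' (gram (↥(maximalRealSubfield L)) e₁ (realDiagonal L dV hdV) (TW (↥(maximalRealSubfield L)) ε)) v)) w w)⟩ (Ψ f)) ∧
      -- (iii) `Ψ` intertwines `ω_v ∘ ch` with the Weil representation of `s′`
      (∀ (g : (cmDatum L 3 (Matrix.of fun i j : Fin 3 => if i.val + j.val + 1 = 3 then (1 : L) else 0)).Local v) (f : SchwartzBruhat (Fin n' → (v.adicCompletion ↥(maximalRealSubfield L)))),
        Ψ (MpPsi.toRep (localSchrodinger (↥(maximalRealSubfield L)) n' (gram (↥(maximalRealSubfield L)) e₁ (realDiagonal L dV hdV) (TW (↥(maximalRealSubfield L)) ε)) v)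
          (((𝓢.s v).comp ((localLineInl L (IsCMField.complexConj L) 3 e₁ (Matrix.diagonal dV) (JW (↥(maximalRealSubfield L)) L ε) v).comp
            ((localPiEquiv L (IsCMField.complexConj L) 3 (Matrix.diagonal dV) v).symm.toMonoidHom.comp (cmDatumLocalCongr L v T ha h).toMonoidHom))) g) f) = MpPsi.toRep (schrodingerSB (dotProductBilin (v.adicCompletion ↥(maximalRealSubfield L)) (v.adicCompletion ↥(maximalRealSubfield L)) (m := Fin 2 ⊕ Fin 1)) (adeleAddCharAt (↥(maximalRealSubfield L)) v) (isLocallyConstant_of_isContinuousNontrivial (isContinuousNontrivial_adeleAddCharAt (↥(maximalRealSubfield L)) v)) (fun y => continuous_dotProductBilin_left y)) (s' g) (Ψ f)) ∧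
      -- (iv) the symplectic component of `s′ g` acts through the chart by the matrix `reindex e₁ (T g T⁻¹ ⊗ 1)`
      (∀ (g : (cmDatum L 3 (Matrix.of fun i j : Fin 3 => if i.val + j.val + 1 = 3 then (1 : L) else 0)).Local v) (x : Fin n' → UnitaryGroup.LocalRing L v),
        ((s' g).1.1).1 (Γ (reIm (quadraticLocalEquiv L v (IsCMField.complexConj L) (complexConj_imagUnit L) (imagUnit_ne_zero L)).toLinearEquiv.toAddEquiv (Fin n') x)) = Γ (reIm (quadraticLocalEquiv L v (IsCMField.complexConj L) (complexConj_imagUnit L) (imagUnit_ne_zero L)).toLinearEquiv.toAddEquiv (Fin n') ((Matrix.reindex e₁ e₁ (((T : Matrix (Fin 3) (Fin 3) (UnitaryGroup.LocalRing L v)) * ((g.val : GL (Fin 3) (UnitaryGroup.LocalRing L v)) : Matrix (Fin 3) (Fin 3) (UnitaryGroup.LocalRing L v)) * ((T⁻¹ : GL (Fin 3) (UnitaryGroup.LocalRing L v)) : Matrix (Fin 3) (Fin 3) (UnitaryGroup.LocalRing L v))) ⊗ₖ (1 : Matrix (Fin 1) (Fin 1) (UnitaryGroup.LocalRing L v))))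 *ᵥ x))) ∧
      -- (v) the fibre over `0`
      (∀ (f : SchwartzBruhat ((Fin 2 ⊕ Fin 1) → (v.adicCompletion ↥(maximalRealSubfield L)))) (u₀ : Fin 1 → (v.adicCompletion ↥(maximalRealSubfield L))),
        (φ₀ f : (Fin 1 → (v.adicCompletion ↥(maximalRealSubfield L))) → ℂ) u₀ = (f : ((Fin 2 ⊕ Fin 1) → (v.adicCompletion ↥(maximalRealSubfield L))) → ℂ) (Sum.elim 0 u₀)) ∧
      -- (vi) the `N`-coboundaries of `ω_v ∘ ch` are the preimage of `ker φ₀`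
      Representation.Coinvariants.ker
        ((((MpPsi.toRep (localSchrodinger (↥(maximalRealSubfield L)) n'
          (gram (↥(maximalRealSubfield L)) e₁ (realDiagonal L dV hdV) (TW (↥(maximalRealSubfield L)) ε)) v)).comp (𝓢.s v)).comp
        ((localLineInl L (IsCMField.complexConj L) 3 e₁ (Matrix.diagonal dV) (JW (↥(maximalRealSubfield L)) L ε) v).comp
          ((localPiEquiv L (IsCMField.complexConj L) 3 (Matrix.diagonal dV) v).symm.toMonoidHom.comp
            (cmDatumLocalCongr L v T ha h).toMonoidHom))).comp (cmBorelTriple L 3 v).N.subtype) =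
        (LinearMap.ker φ₀).comap (Ψ : SchwartzBruhat (Fin n' → (v.adicCompletion ↥(maximalRealSubfield L))) →ₗ[ℂ] SchwartzBruhat ((Fin 2 ⊕ Fin 1) → (v.adicCompletion ↥(maximalRealSubfield L)))) := by
  classical
  -- the two docking identities ★ p832169 (F0P3a-p03 (g8))
  have hiota : ∀ (u : localPi L (IsCMField.complexConj L) n' (Matrix.reindex e₁ e₁ (Matrix.diagonal dV ⊗ₖ JW (↥(maximalRealSubfield L)) L ε)) v)
      (x : Fin n' → UnitaryGroup.LocalRing L v),
      ((iota (↥(maximalRealSubfield L)) L (IsCMField.complexConj L) n' (complexConj_imagUnit L) (imagUnit_ne_zero L) (imagUnit_mul_self L)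
          (gram (↥(maximalRealSubfield L)) e₁ (realDiagonal L dV hdV) (TW (↥(maximalRealSubfield L)) ε))
          (isSymm_gram (↥(maximalRealSubfield L)) e₁ (realDiagonal_isSymm L dV hdV) (isSymm_TW (↥(maximalRealSubfield L)) ε))
          (reindex_kronecker_eq_gram_map (↥(maximalRealSubfield L)) L e₁ (realDiagonal_map L dV hdV).symm (JW_eq (↥(maximalRealSubfield L)) L ε))
          v u).1)
        (reIm (quadraticLocalEquiv L v (IsCMField.complexConj L) (complexConj_imagUnit L) (imagUnit_ne_zero L)).toLinearEquiv.toAddEquiv (Fin n') x) =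
      reIm (quadraticLocalEquiv L v (IsCMField.complexConj L) (complexConj_imagUnit L) (imagUnit_ne_zero L)).toLinearEquiv.toAddEquiv (Fin n')
        ((((localPiEquiv L (IsCMField.complexConj L) n' (Matrix.reindex e₁ e₁ (Matrix.diagonal dV ⊗ₖ JW (↥(maximalRealSubfield L)) L ε)) v u :
            ↥(UnitaryGroup.«local» L (IsCMField.complexConj L) n' (Matrix.reindex e₁ e₁ (Matrix.diagonal dV ⊗ₖ JW (↥(maximalRealSubfield L)) L ε)) v)) :
            GL (Fin n') (UnitaryGroup.LocalRing L v)) : Matrix (Fin n') (Fin n') (UnitaryGroup.LocalRing L v)) *ᵥ x) := fun u x =>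
    iota_fst_reIm L (IsCMField.complexConj L) v (complexConj_imagUnit L) (imagUnit_ne_zero L) (imagUnit_mul_self L) _ _ _ u x
  have hdock : ∀ g : (cmDatum L 3 (Matrix.diagonal dV)).Local v,
      (((localPiEquiv L (IsCMField.complexConj L) n' (Matrix.reindex e₁ e₁ (Matrix.diagonal dV ⊗ₖ JW (↥(maximalRealSubfield L)) L ε)) v
          (localLineInl L (IsCMField.complexConj L) 3 e₁ (Matrix.diagonal dV) (JW (↥(maximalRealSubfield L)) L ε) v
            ((localPiEquiv L (IsCMField.complexConj L) 3 (Matrix.diagonal dV) v).symm g)) :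
            ↥(UnitaryGroup.«local» L (IsCMField.complexConj L) n' (Matrix.reindex e₁ e₁ (Matrix.diagonal dV ⊗ₖ JW (↥(maximalRealSubfield L)) L ε)) v)) :
            GL (Fin n') (UnitaryGroup.LocalRing L v)) : Matrix (Fin n') (Fin n') (UnitaryGroup.LocalRing L v)) =
        Matrix.reindex e₁ e₁ (((g.val : GL (Fin 3) (UnitaryGroup.LocalRing L v)) : Matrix (Fin 3) (Fin 3) (UnitaryGroup.LocalRing L v)) ⊗ₖ
          (1 : Matrix (Fin 1) (Fin 1) (UnitaryGroup.LocalRing L v))) := fun g =>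
    coe_coe_localPiEquiv_localLineInl_localPiEquiv_symm L (IsCMField.complexConj L) 3 e₁ (Matrix.diagonal dV) (JW (↥(maximalRealSubfield L)) L ε) v g
  -- the quadratic coordinates of `S = L ⊗ L⁺_v` and the involution
  have hq := isQuadraticCoordinates_local L v (IsCMField.complexConj L) (complexConj_imagUnit L) (imagUnit_ne_zero L) (imagUnit_mul_self L)
  have hσφ : ∀ x : v.adicCompletion ↥(maximalRealSubfield L),
      conjLocal L (IsCMField.complexConj L) v (toLocalRing L v x) = toLocalRing L v x := fun x => conjLocal_toLocalRing (IsCMField.complexConj L) v x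
  have hσδ : conjLocal L (IsCMField.complexConj L) v (algebraMap L (UnitaryGroup.LocalRing L v) (imagUnit L)) =
      -algebraMap L (UnitaryGroup.LocalRing L v) (imagUnit L) := by rw [conjLocal_algebraMap, complexConj_imagUnit, map_neg]
  have hσσ : ∀ z, conjLocal L (IsCMField.complexConj L) v (conjLocal L (IsCMField.complexConj L) v z) = z := conjLocal_conjLocal_cm L v
  -- `S` is a field (non-split), `2` is a unit, `d` is not a square
  obtain ⟨w⟩ := PlacesOver.nonempty L v
  have hS : IsField (UnitaryGroup.LocalRing L v) := LocalRing.isField_of_smul_eq (IsCMField.complexConj L) (IsCMField.complexConj_ne_one L) w (hv w)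
  have h2F : (2 : v.adicCompletion ↥(maximalRealSubfield L)) ≠ 0 := two_ne_zero
  have h2 : (2 : UnitaryGroup.LocalRing L v) ≠ 0 := by
    intro h0
    apply h2F
    have : toLocalRing L v 2 = toLocalRing L v 0 := by rw [map_ofNat, map_zero, h0]
    exact (toLocalRing L v).injective this
  have hδ0 : algebraMap L (UnitaryGroup.LocalRing L v) (imagUnit L) ≠ 0 :=
    (map_ne_zero_iff _ (algebraMap L (UnitaryGroup.LocalRing L v)).injective).2 (imagUnit_ne_zero L)
  have hd := mul_self_ne_of_isField hq hS hσφ hσδ hδ0 h2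
  -- the real Gram `𝕋_v` of the pair: symmetric, invertible
  have hT : (localGram (↥(maximalRealSubfield L)) n' (gram (↥(maximalRealSubfield L)) e₁ (realDiagonal L dV hdV) (TW (↥(maximalRealSubfield L)) ε)) v).IsSymm :=
    (isSymm_gram (↥(maximalRealSubfield L)) e₁ (realDiagonal_isSymm L dV hdV) (isSymm_TW (↥(maximalRealSubfield L)) ε)).map _
  have hTd : IsUnit (localGram (↥(maximalRealSubfield L)) n'
      (gram (↥(maximalRealSubfield L)) e₁ (realDiagonal L dV hdV) (TW (↥(maximalRealSubfield L)) ε)) v).det :=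
    isUnit_det_map _ (isUnit_det_gram (↥(maximalRealSubfield L)) e₁ (isUnit_det_realDiagonal L dV hdV hdV0) (isUnit_det_TW (↥(maximalRealSubfield L)) ε))
  -- the hermitian form of the pair on `S^{n'}` is `reindex e₁ (H_V ⊗ H_W)`
  obtain ⟨HV, hHV⟩ : ∃ HV : Matrix (Fin 3) (Fin 3) (UnitaryGroup.LocalRing L v),
      HV = (Matrix.diagonal dV).map (algebraMap L (UnitaryGroup.LocalRing L v)) := ⟨_, rfl⟩
  obtain ⟨HW, hHW⟩ : ∃ HW : Matrix (Fin 1) (Fin 1) (UnitaryGroup.LocalRing L v),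
      HW = (JW (↥(maximalRealSubfield L)) L ε).map (algebraMap L (UnitaryGroup.LocalRing L v)) := ⟨_, rfl⟩
  have hH : (localGram (↥(maximalRealSubfield L)) n' (gram (↥(maximalRealSubfield L)) e₁ (realDiagonal L dV hdV) (TW (↥(maximalRealSubfield L)) ε)) v).map
      (toLocalRing L v) = Matrix.reindex e₁ e₁ (HV ⊗ₖ HW) := by
    rw [localGram, ← localForm_eq_map L n' v _ (reindex_kronecker_eq_gram_map (↥(maximalRealSubfield L)) L e₁ (realDiagonal_map L dV hdV).symm
      (JW_eq (↥(maximalRealSubfield L)) L ε)), adelicForm, Matrix.map_map, hHV, hHW, kronecker_map_map]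
    have hcomp : ((adeleToLocal L v : AdeleRing (𝓞 L) L →+* UnitaryGroup.LocalRing L v) : AdeleRing (𝓞 L) L → UnitaryGroup.LocalRing L v) ∘
        (algebraMap L (AdeleRing (𝓞 L) L)) = algebraMap L (UnitaryGroup.LocalRing L v) := funext fun e => adeleToLocal_algebraMap L v e
    rw [hcomp]
    ext i j
    simp only [Matrix.reindex_apply, Matrix.submatrix_apply, Matrix.map_apply]
  -- the unit `u = a · ε′` of the frame and its reality
  have hW00 : HW 0 0 = algebraMap L (UnitaryGroup.LocalRing L v) (algebraMap (↥(maximalRealSubfield L)) L (ε : ↥(maximalRealSubfield L))) := by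
    rw [hHW, Matrix.map_apply, JW_eq, Matrix.map_apply, TW]; rfl
  have hW : IsUnit (HW 0 0) := by rw [hW00]; exact (ε.isUnit.map _).map _
  have hA : ∀ i j : Fin 3, ((Matrix.of fun i j : Fin 3 => if i.val + j.val + 1 = 3 then (1 : L) else 0).map
      (algebraMap L (UnitaryGroup.LocalRing L v))) i j = if i.val + j.val + 1 = 3 then 1 else 0 := fun i j => by
    rw [Matrix.map_apply, Matrix.of_apply]; split_ifs <;> simp
  have h' : formCongr (conjLocal L (IsCMField.complexConj L) v) T HV = ((ha.unit : (UnitaryGroup.LocalRing L v)ˣ) : UnitaryGroup.LocalRing L v) •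
      (Matrix.of fun i j : Fin 3 => if i.val + j.val + 1 = 3 then (1 : L) else 0).map (algebraMap L (UnitaryGroup.LocalRing L v)) := by
    rw [hHV, IsUnit.unit_spec]; exact h
  have hcc : ∀ i j : Fin 3, hermForm (conjLocal L (IsCMField.complexConj L) v) HV ((T : Matrix (Fin 3) (Fin 3) _).col i)
      ((T : Matrix (Fin 3) (Fin 3) _).col j) * HW 0 0 =
        if i.val + j.val + 1 = 3 then ((ha.unit * hW.unit : (UnitaryGroup.LocalRing L v)ˣ) : UnitaryGroup.LocalRing L v) else 0 :=
    fun i j => by rw [hermForm_col_col_eq _ HV T ha.unit hA h', ite_mul, zero_mul, Units.val_mul, hW.unit_spec]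
  have hHVh : (HV.map (conjLocal L (IsCMField.complexConj L) v))ᵀ = HV := by
    rw [hHV, Matrix.diagonal_map (map_zero _), Matrix.diagonal_map (map_zero _), Matrix.diagonal_transpose]
    congr 1
    funext i
    rw [conjLocal_algebraMap, hdV]
  have hσW : conjLocal L (IsCMField.complexConj L) v (HW 0 0) = HW 0 0 := by rw [hW00, conjLocal_algebraMap, AlgEquiv.commutes]
  have hσu : conjLocal L (IsCMField.complexConj L) v ((ha.unit * hW.unit : (UnitaryGroup.LocalRing L v)ˣ) : UnitaryGroup.LocalRing L v) =
      ((ha.unit * hW.unit : (UnitaryGroup.LocalRing L v)ˣ) : UnitaryGroup.LocalRing L v) := by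
    rw [Units.val_mul, map_mul, map_unit_eq _ HV T ha.unit hA h' hσσ hHVh, hW.unit_spec, hσW]
  obtain ⟨u, hudef⟩ : ∃ u : (UnitaryGroup.LocalRing L v)ˣ, u = ha.unit * hW.unit := ⟨_, rfl⟩
  rw [← hudef] at hcc hσu
  obtain ⟨a₀, ha₀def⟩ : ∃ a₀ : v.adicCompletion ↥(maximalRealSubfield L),
      a₀ = re (quadraticLocalEquiv L v (IsCMField.complexConj L) (complexConj_imagUnit L) (imagUnit_ne_zero L)).toLinearEquiv.toAddEquiv
        (u : UnitaryGroup.LocalRing L v) := ⟨_, rfl⟩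
  have hu : (u : UnitaryGroup.LocalRing L v) = toLocalRing L v a₀ := by rw [ha₀def]; exact eq_map_re_of_conj_eq hq hσφ hσδ h2F hσu
  have ha₀ : a₀ ≠ 0 := fun h0 => u.ne_zero (by rw [hu, h0, map_zero])
  have hφa : toLocalRing L v a₀⁻¹ = ((u⁻¹ : (UnitaryGroup.LocalRing L v)ˣ) : UnitaryGroup.LocalRing L v) :=
    (Units.inv_eq_of_mul_eq_one_right (show (u : UnitaryGroup.LocalRing L v) * toLocalRing L v a₀⁻¹ = 1 by
      rw [hu, ← map_mul, mul_inv_cancel₀ ha₀, map_one])).symm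
  -- the lift `x ⊗ w₀` and the frame package ★ p832092
  obtain ⟨Lf, hLf⟩ : ∃ Lf : (Fin 3 → UnitaryGroup.LocalRing L v) →ₗ[UnitaryGroup.LocalRing L v] (Fin n' → UnitaryGroup.LocalRing L v),
      ∀ x k, Lf x k = x (e₁.symm k).1 :=
    ⟨LinearMap.funLeft (UnitaryGroup.LocalRing L v) (UnitaryGroup.LocalRing L v) (fun k => (e₁.symm k).1), fun _ _ => rfl⟩
  -- the group side: the chain `Gqs → localPi`, the splitting `s`, the matrix action `M`
  obtain ⟨ch, hch⟩ : ∃ ch : (cmDatum L 3 (Matrix.of fun i j : Fin 3 => if i.val + j.val + 1 = 3 then (1 : L) else 0)).Local v →*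
      localPi L (IsCMField.complexConj L) n' (Matrix.reindex e₁ e₁ (Matrix.diagonal dV ⊗ₖ JW (↥(maximalRealSubfield L)) L ε)) v,
      ch = (localLineInl L (IsCMField.complexConj L) 3 e₁ (Matrix.diagonal dV) (JW (↥(maximalRealSubfield L)) L ε) v).comp
          ((localPiEquiv L (IsCMField.complexConj L) 3 (Matrix.diagonal dV) v).symm.toMonoidHom.comp
            (cmDatumLocalCongr L v T ha h).toMonoidHom) := ⟨_, rfl⟩
  have hchap : ∀ g, ch g = localLineInl L (IsCMField.complexConj L) 3 e₁ (Matrix.diagonal dV) (JW (↥(maximalRealSubfield L)) L ε) v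
      ((localPiEquiv L (IsCMField.complexConj L) 3 (Matrix.diagonal dV) v).symm (cmDatumLocalCongr L v T ha h g)) := fun g => by
    rw [hch]; rfl
  obtain ⟨s, hs⟩ : ∃ s : _ →* LocalMp (↥(maximalRealSubfield L)) n'
      (gram (↥(maximalRealSubfield L)) e₁ (realDiagonal L dV hdV) (TW (↥(maximalRealSubfield L)) ε)) v, s = (𝓢.s v).comp ch := ⟨_, rfl⟩
  obtain ⟨M, hMval⟩ : ∃ M : (cmDatum L 3 (Matrix.of fun i j : Fin 3 => if i.val + j.val + 1 = 3 then (1 : L) else 0)).Local v →*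
      GL (Fin n') (UnitaryGroup.LocalRing L v), ∀ g, M g =
        ((localPiEquiv L (IsCMField.complexConj L) n' (Matrix.reindex e₁ e₁ (Matrix.diagonal dV ⊗ₖ JW (↥(maximalRealSubfield L)) L ε)) v (ch g) :
          ↥(UnitaryGroup.«local» L (IsCMField.complexConj L) n' (Matrix.reindex e₁ e₁ (Matrix.diagonal dV ⊗ₖ JW (↥(maximalRealSubfield L)) L ε)) v)) :
          GL (Fin n') (UnitaryGroup.LocalRing L v)) :=
    ⟨(UnitaryGroup.«local» L (IsCMField.complexConj L) n' (Matrix.reindex e₁ e₁ (Matrix.diagonal dV ⊗ₖ JW (↥(maximalRealSubfield L)) L ε)) v).subtype.comp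
      ((localPiEquiv L (IsCMField.complexConj L) n' (Matrix.reindex e₁ e₁ (Matrix.diagonal dV ⊗ₖ JW (↥(maximalRealSubfield L)) L ε)) v).toMonoidHom.comp ch),
      fun _ => rfl⟩
  -- the matrix of `M g`: `reindex e₁ (T g T⁻¹ ⊗ 1)`
  have hMmat : ∀ g, ((M g : GL (Fin n') (UnitaryGroup.LocalRing L v)) : Matrix (Fin n') (Fin n') (UnitaryGroup.LocalRing L v)) =
      Matrix.reindex e₁ e₁ (((T : Matrix (Fin 3) (Fin 3) (UnitaryGroup.LocalRing L v)) * ((g.val : GL (Fin 3) _) : Matrix (Fin 3) (Fin 3) _) *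
        ((T⁻¹ : GL (Fin 3) (UnitaryGroup.LocalRing L v)) : Matrix (Fin 3) (Fin 3) _)) ⊗ₖ (1 : Matrix (Fin 1) (Fin 1) (UnitaryGroup.LocalRing L v))) := by
    intro g
    rw [hMval, hchap, hdock, coe_cmDatumLocalCongr_apply, Units.val_mul, Units.val_mul]
  -- `M g` is an isometry of the pair form
  have hM : ∀ g, M g ∈ unitaryGroupOfForm (conjLocal L (IsCMField.complexConj L) v)
      ((localGram (↥(maximalRealSubfield L)) n' (gram (↥(maximalRealSubfield L)) e₁ (realDiagonal L dV hdV) (TW (↥(maximalRealSubfield L)) ε)) v).map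
        (toLocalRing L v)) := by
    intro g
    have hmem := (localPiEquiv L (IsCMField.complexConj L) n' (Matrix.reindex e₁ e₁ (Matrix.diagonal dV ⊗ₖ JW (↥(maximalRealSubfield L)) L ε)) v (ch g)).2
    rw [hMval, localGram, ← localForm_eq_map L n' v _ (reindex_kronecker_eq_gram_map (↥(maximalRealSubfield L)) L e₁ (realDiagonal_map L dV hdV).symm
      (JW_eq (↥(maximalRealSubfield L)) L ε))]
    exact hmem
  -- `hι`: the symplectic component of `s g` acts by the matrix `M g`
  have hι : ∀ (g) (x : Fin n' → UnitaryGroup.LocalRing L v), ((s g).1.1).1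
      (reIm (quadraticLocalEquiv L v (IsCMField.complexConj L) (complexConj_imagUnit L) (imagUnit_ne_zero L)).toLinearEquiv.toAddEquiv (Fin n') x) =
      reIm (quadraticLocalEquiv L v (IsCMField.complexConj L) (complexConj_imagUnit L) (imagUnit_ne_zero L)).toLinearEquiv.toAddEquiv (Fin n')
        (((M g : GL (Fin n') (UnitaryGroup.LocalRing L v)) : Matrix (Fin n') (Fin n') (UnitaryGroup.LocalRing L v)) *ᵥ x) := by
    intro g x
    have hp : (s g).1.1 = iota (↥(maximalRealSubfield L)) L (IsCMField.complexConj L) n' (complexConj_imagUnit L) (imagUnit_ne_zero L) (imagUnit_mul_self L)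
        (gram (↥(maximalRealSubfield L)) e₁ (realDiagonal L dV hdV) (TW (↥(maximalRealSubfield L)) ε))
        (isSymm_gram (↥(maximalRealSubfield L)) e₁ (realDiagonal_isSymm L dV hdV) (isSymm_TW (↥(maximalRealSubfield L)) ε))
        (reindex_kronecker_eq_gram_map (↥(maximalRealSubfield L)) L e₁ (realDiagonal_map L dV hdV).symm (JW_eq (↥(maximalRealSubfield L)) L ε))
        v (ch g) := by
      rw [hs]; exact 𝓢.proj_s v (ch g)
    rw [hp, hiota, hMval]
  -- the Borel data of `U(Φ₃)(L⁺_v)` over the FIELD `S` (non-split `v`)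
  have hJ3 := cmLocalForm_eq_over L 3 v
  letI : Field (UnitaryGroup.LocalRing L v) := hS.toField
  -- (hN) every `n ∈ N` is `Y^⊥`-trivial
  have hN : ∀ nn ∈ (cmBorelTriple L 3 v).N,
      ((M nn⁻¹ : GL (Fin n') (UnitaryGroup.LocalRing L v)) : Matrix (Fin n') (Fin n') _) *ᵥ Lf ((T : Matrix (Fin 3) (Fin 3) _).col 0) =
        Lf ((T : Matrix (Fin 3) (Fin 3) _).col 0) ∧
      ∀ j : Fin 1, ∃ μ : UnitaryGroup.LocalRing L v, ((M nn⁻¹ : GL (Fin n') (UnitaryGroup.LocalRing L v)) : Matrix (Fin n') (Fin n') _) *ᵥ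
        (![Lf ((T : Matrix (Fin 3) (Fin 3) _).col 1)] : Fin 1 → Fin n' → _) j =
        (![Lf ((T : Matrix (Fin 3) (Fin 3) _).col 1)] : Fin 1 → Fin n' → _) j + μ • Lf ((T : Matrix (Fin 3) (Fin 3) _).col 0) := by
    intro nn hnn
    obtain ⟨x, z, hmat, -⟩ := exists_coe_eq_upper_of_mem_unipotentU (conjLocal L (IsCMField.complexConj L) v) hJ3 hσσ hnn
    have hinv : (((nn⁻¹ : (cmDatum L 3 (Matrix.of fun i j : Fin 3 => if i.val + j.val + 1 = 3 then (1 : L) else 0)).Local v).val : GL (Fin 3) _) :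
        Matrix (Fin 3) (Fin 3) (UnitaryGroup.LocalRing L v)) =
        !![1, -x, x * (-(conjLocal L (IsCMField.complexConj L) v x)) - z; 0, 1, -(-(conjLocal L (IsCMField.complexConj L) v x)); 0, 0, 1] :=
      coe_inv_upper hmat
    have hMm := hMmat nn⁻¹
    rw [hinv] at hMm
    obtain ⟨h0, h1, -⟩ := pairFrame_action_upper e₁ Lf hLf T u (-x) (-(-(conjLocal L (IsCMField.complexConj L) v x)))
      (x * (-(conjLocal L (IsCMField.complexConj L) v x)) - z)
    rw [hMm]
    exact ⟨h0, h1⟩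
  -- (hgen) `N` is generated by torus conjugation-quotients and commutators (★ p831536), the torus is frame-diagonal
  have hgen : ∀ nn ∈ (cmBorelTriple L 3 v).N, ∃ t : ↥(unitaryGroupOfForm (conjLocal L (IsCMField.complexConj L) v) (cmLocalForm L 3 v)),
      (∃ α : UnitaryGroup.LocalRing L v, ((M t⁻¹ : GL (Fin n') (UnitaryGroup.LocalRing L v)) : Matrix (Fin n') (Fin n') _) *ᵥ
        Lf ((T : Matrix (Fin 3) (Fin 3) _).col 0) = α • Lf ((T : Matrix (Fin 3) (Fin 3) _).col 0)) ∧
      (∀ j : Fin 1, ∃ ν : UnitaryGroup.LocalRing L v, ((M t⁻¹ : GL (Fin n') (UnitaryGroup.LocalRing L v)) : Matrix (Fin n') (Fin n') _) *ᵥ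
        (![Lf ((T : Matrix (Fin 3) (Fin 3) _).col 1)] : Fin 1 → Fin n' → _) j = ν • (![Lf ((T : Matrix (Fin 3) (Fin 3) _).col 1)] : Fin 1 → Fin n' → _) j) ∧
      ∃ n₁ ∈ (cmBorelTriple L 3 v).N, ∃ n₂ ∈ (cmBorelTriple L 3 v).N, nn = t * nn * t⁻¹ * nn⁻¹ * (n₁ * n₂ * n₁⁻¹ * n₂⁻¹) := by
    intro nn hnn
    obtain ⟨t, htT, n₁, hn₁, n₂, hn₂, heq⟩ := exists_eq_conjQuot_mul_commutator (conjLocal L (IsCMField.complexConj L) v) hJ3 hσσ h2 hnn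
    obtain ⟨dd, hdd, -⟩ := exists_coe_eq_diagonal_of_mem_torusU (conjLocal L (IsCMField.complexConj L) v) hJ3 (inv_mem htT)
    have hMm := hMmat t⁻¹
    rw [show (((t⁻¹ : (cmDatum L 3 (Matrix.of fun i j : Fin 3 => if i.val + j.val + 1 = 3 then (1 : L) else 0)).Local v).val : GL (Fin 3) _) :
        Matrix (Fin 3) (Fin 3) (UnitaryGroup.LocalRing L v)) =
        Matrix.diagonal (fun i => ((dd i : (UnitaryGroup.LocalRing L v)ˣ) : UnitaryGroup.LocalRing L v)) from hdd] at hMm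
    obtain ⟨h0, h1⟩ := pairFrame_action_diagonal e₁ Lf hLf T (fun i => ((dd i : (UnitaryGroup.LocalRing L v)ˣ) : UnitaryGroup.LocalRing L v))
    refine ⟨t, ?_, ?_, n₁, hn₁, n₂, hn₂, heq⟩
    · rw [hMm]; exact h0
    · rw [hMm]; exact h1
  -- (hZ) the centre family `u(0, u·φ(t)·δ)`
  have hZ : ∀ tF : v.adicCompletion ↥(maximalRealSubfield L), ∃ nn ∈ (cmBorelTriple L 3 v).N,
      ((M nn⁻¹ : GL (Fin n') (UnitaryGroup.LocalRing L v)) : Matrix (Fin n') (Fin n') _) *ᵥ Lf ((T : Matrix (Fin 3) (Fin 3) _).col 0) =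
        Lf ((T : Matrix (Fin 3) (Fin 3) _).col 0) ∧
      (∀ j : Fin 1, ((M nn⁻¹ : GL (Fin n') (UnitaryGroup.LocalRing L v)) : Matrix (Fin n') (Fin n') _) *ᵥ
        (![Lf ((T : Matrix (Fin 3) (Fin 3) _).col 1)] : Fin 1 → Fin n' → _) j = (![Lf ((T : Matrix (Fin 3) (Fin 3) _).col 1)] : Fin 1 → Fin n' → _) j) ∧
      ∃ μ : UnitaryGroup.LocalRing L v, ((M nn⁻¹ : GL (Fin n') (UnitaryGroup.LocalRing L v)) : Matrix (Fin n') (Fin n') _) *ᵥ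
        Lf (((u⁻¹ : (UnitaryGroup.LocalRing L v)ˣ) : UnitaryGroup.LocalRing L v) • (T : Matrix (Fin 3) (Fin 3) _).col 2) =
        Lf (((u⁻¹ : (UnitaryGroup.LocalRing L v)ˣ) : UnitaryGroup.LocalRing L v) • (T : Matrix (Fin 3) (Fin 3) _).col 2) +
          μ • Lf ((T : Matrix (Fin 3) (Fin 3) _).col 0) ∧
        conjLocal L (IsCMField.complexConj L) v μ = toLocalRing L v tF * algebraMap L (UnitaryGroup.LocalRing L v) (imagUnit L) := by
    intro tF
    have hrel : (u : UnitaryGroup.LocalRing L v) * (toLocalRing L v tF * algebraMap L (UnitaryGroup.LocalRing L v) (imagUnit L)) +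
        conjLocal L (IsCMField.complexConj L) v ((u : UnitaryGroup.LocalRing L v) * (toLocalRing L v tF * algebraMap L _ (imagUnit L))) +
        0 * conjLocal L (IsCMField.complexConj L) v 0 = 0 := by
      rw [map_mul, map_mul, hσu, hσφ, hσδ]; ring
    obtain ⟨nn, hnnN, hmat⟩ := exists_mem_unipotentU_coe_eq (conjLocal L (IsCMField.complexConj L) v) hJ3 hσσ hrel
    have hinv : (((nn⁻¹ : (cmDatum L 3 (Matrix.of fun i j : Fin 3 => if i.val + j.val + 1 = 3 then (1 : L) else 0)).Local v).val : GL (Fin 3) _) :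
        Matrix (Fin 3) (Fin 3) (UnitaryGroup.LocalRing L v)) =
        !![1, 0, -((u : UnitaryGroup.LocalRing L v) * (toLocalRing L v tF * algebraMap L (UnitaryGroup.LocalRing L v) (imagUnit L))); 0, 1, 0; 0, 0, 1] := by
      refine (coe_inv_upper hmat).trans ?_
      simp
    have hMm := hMmat nn⁻¹
    rw [hinv] at hMm
    obtain ⟨h0, h1, h2'⟩ := pairFrame_action_centre e₁ Lf hLf T u
      (-((u : UnitaryGroup.LocalRing L v) * (toLocalRing L v tF * algebraMap L (UnitaryGroup.LocalRing L v) (imagUnit L))))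
    refine ⟨nn, hnnN, ?_, ?_, ⟨-((u : UnitaryGroup.LocalRing L v) * (toLocalRing L v tF * algebraMap L (UnitaryGroup.LocalRing L v) (imagUnit L))) *
      ((u⁻¹ : (UnitaryGroup.LocalRing L v)ˣ) : UnitaryGroup.LocalRing L v), ?_, ?_⟩⟩
    · rw [hMm]; exact h0
    · rw [hMm]; exact h1
    · rw [hMm]; exact h2'
    · rw [map_mul, map_neg, map_mul, map_mul, hσu, hσφ, hσδ, map_units_inv_of_map_eq _ hσu, mul_neg, mul_neg, neg_neg,
        mul_comm (u : UnitaryGroup.LocalRing L v) (toLocalRing L v tF * _), Units.mul_inv_cancel_right]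
  -- assemble with (E1-gen) `exists_chart_of_frame` — adapted from ★ p832817 (A-p12 (g17)), whose hypothesis discharge above is kept VERBATIM
  have key := exists_chart_of_frame (m := 1) _ hq _ s M (cmBorelTriple L 3 v).N (isContinuousNontrivial_adeleAddCharAt _ v) hd hσφ hσδ hσσ
    hT hTd (by rw [hH]; exact pairFrame_hx _ HV HW e₁ Lf hLf T u hcc) (by rw [hH]; exact pairFrame_hy _ HV HW e₁ Lf hLf T u hcc)
    (by rw [hH]; exact pairFrame_hxy _ HV HW e₁ Lf hLf T u hcc) (fun j => by rw [hH]; exact pairFrame_hxb _ HV HW e₁ Lf hLf T u hcc j)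
    (fun j => by rw [hH]; exact pairFrame_hyb _ HV HW e₁ Lf hLf T u hcc j) (fun j j' hjj => by rw [hH]; exact pairFrame_hbb _ HV HW e₁ Lf T j j' hjj)
    (a := fun _ : Fin 1 => a₀) (fun j => by rw [hH, ← hu]; exact pairFrame_hba _ HV HW e₁ Lf hLf T u hcc j) (fun _ => ha₀)
    (fun w' => by rw [hH, hφa]; exact pairFrame_hexp _ HV HW e₁ Lf hLf T u hcc hσu w') hM hι hN hgen hZ
  obtain ⟨Γ, Ψ, s', φ₀, h1, -, h3, h4, h5, h6, h7, h8⟩ := key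
  -- the frame vectors and the unit, concretely
  have hx0 : Lf ((T : Matrix (Fin 3) (Fin 3) (UnitaryGroup.LocalRing L v)).col 0) = (fun k => (T : Matrix (Fin 3) (Fin 3) (UnitaryGroup.LocalRing L v)) (e₁.symm k).1 0) := funext fun k => hLf _ k
  have hb0 : Lf ((T : Matrix (Fin 3) (Fin 3) (UnitaryGroup.LocalRing L v)).col 1) = (fun k => (T : Matrix (Fin 3) (Fin 3) (UnitaryGroup.LocalRing L v)) (e₁.symm k).1 1) := funext fun k => hLf _ k
  have hy0 : Lf (((u⁻¹ : (UnitaryGroup.LocalRing L v)ˣ) : UnitaryGroup.LocalRing L v) • (T : Matrix (Fin 3) (Fin 3) (UnitaryGroup.LocalRing L v)).col 2) = (fun k => ((u⁻¹ : (UnitaryGroup.LocalRing L v)ˣ) : UnitaryGroup.LocalRing L v) * (T : Matrix (Fin 3) (Fin 3) (UnitaryGroup.LocalRing L v)) (e₁.symm k).1 2) :=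
    funext fun k => by rw [hLf]; rfl
  have huval : (u : UnitaryGroup.LocalRing L v) = a * algebraMap L (UnitaryGroup.LocalRing L v) (algebraMap (↥(maximalRealSubfield L)) L (ε : ↥(maximalRealSubfield L))) := by
    rw [hudef, Units.val_mul, IsUnit.unit_spec, IsUnit.unit_spec, hW00]
  refine ⟨u, a₀, Γ, Ψ, s', φ₀, ⟨huval, hu⟩, hH.trans (by rw [hHV, hHW]), fun x => ?_, h3, h4, fun g f => ?_, fun g x => ?_, h7, ?_⟩
  · -- (i)
    rw [h1 x, hx0, hy0]
    simp only [Matrix.cons_val_fin_one, hb0]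
  · -- (iii): `((𝓢.s v).comp ch) g`, kept as a composite (`MonoidHom.comp_apply` is `rfl` for the consumer; `rw` with it here is an `isDefEq` wall)
    have h := h5
    rw [hs, hch] at h
    exact h g f
  · -- (iv)
    rw [h6 g x, hMmat g]
  · -- (vi)
    rw [hs, hch] at h8
    exact h8

end Chart

end Summit.HodgeConjecture.HodgeConjecture.Cruxes.H413.F0P2oYCoinvariantsChartCM

end
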